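import Mathlib
import Summits.NavierStokesRegularity.NavierStokesRegularity.Theorems.EulerZoomLiouvillePowerGaugeEulerLiouvilleEnergySaturationLoc
import HarnessLib

/-!
# Energy saturation on the crux `EulerZoomLiouville.PowerGaugeEulerLiouville` — the SCALE ODE of the cut-off energy at an ARBITRARY collapse rate
# (crux = stmt-NavierStokesRegularity-19832, route №10 `EulerZoomLiouville`; line `logtime-breathers`, residue T4 `stub_powerClockRest`)

Width seat `ns-ezl-w6` (cell ns-regularity-ideate, LEAD ns-typeII-p2).  The tree's `EnergySaturation.hasDerivAt_normEnergy_of_energyEquality`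
(…EnergySaturationIdentity) is the scale ODE `(L^{2ρ−1} J)' = (2+ρ) L^{2ρ−2} F_σ` of the cut-off energy `J(L) = ∫σ(L⁻¹y)|V|²` at the class rate
`γ = 1/(2+ρ)`.  Here the same computation at an ARBITRARY rate `γ ≠ 0` (positive or negative): from the profile local energy equality
`(2 − 5γ)J(L) = F_σ(L) + γ∫|V|²⟪x,∇σ_L⟫` and `∫|V|²⟪x,∇σ_L⟫ = −L J'(L)`, one gets `(L^{2/γ−5} J)'(L) = γ⁻¹ L^{2/γ−6} F_σ(L)` (`2 − 5γ = γ(2/γ − 5)`).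
Used by `…EnergySaturationNegRate` (rates `γ < 0`).  WHAT THIS IS NOT: not NS, not E — a calculus lemma, `--supports` stmt-19832.
[folklore; cf. ChaeShvydkoy2013 §2.2 (2.12)]
-/

noncomputable section

-- flat `Theorems/<Route><Decl>…` files of one crux share the namespace of the crux (tree convention: `Summit.<S>.<S>.…`)
set_option linter.dupNamespace false

open MeasureTheory Set Filter Topology Metric Function TopologicalSpace
open scoped ENNReal NNReal RealInnerProductSpace ContDiff

namespace Summit.NavierStokesRegularity.NavierStokesRegularity.Theorems.PowerGaugeEulerLiouville

open Literature.Analysis Literature.Analysis.FunctionSpaces Literature.Analysis.FluidPDE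

namespace EnergySaturation

section ScaleODE

variable {γ : ℝ} {σ : EuclideanSpace ℝ (Fin 3) → ℝ}
  {V : EuclideanSpace ℝ (Fin 3) → EuclideanSpace ℝ (Fin 3)} {P : EuclideanSpace ℝ (Fin 3) → ℝ}

/-- **The scale ODE at an arbitrary rate.**  `σ` a test function, `|V|² ∈ L¹_loc`, and the profile local energy equality of a rate-`γ` collapse
(`γ ≠ 0`) for the rescaled cut-off `σ_L = σ(L⁻¹·)`.  Then `J(L) = ∫σ(L⁻¹y)|V|²` satisfies `(L^{2/γ−5} J)'(L) = γ⁻¹ L^{2/γ−6} F_σ(L)`,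
`F_σ(L) = ∫(|V|²+2P)⟪V,∇σ_L⟫` (since `γ⟪y,∇σ_L(y)⟫ = γ Dσ(L⁻¹y)[L⁻¹y]` and `2 − 5γ = γ(2/γ − 5)`). [folklore; cf. ChaeShvydkoy2013 §2.2 (2.12)] -/
theorem hasDerivAt_rpowMul_cutoffEnergy_of_energyEquality (hγ : γ ≠ 0)
    (hσ : IsTestFunctionOn (⊤ : Opens (EuclideanSpace ℝ (Fin 3))) σ)
    (hVm : AEStronglyMeasurable V volume)
    (hV2 : LocallyIntegrable (fun y => ‖V y‖ ^ 2) volume)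
    {L : ℝ} (hL : 0 < L)
    (hEE : (2 - 5 * γ) * ∫ x, σ (L⁻¹ • x) * ‖V x‖ ^ 2 =
      (∫ x, (‖V x‖ ^ 2 + 2 * P x) * ⟪V x, gradient (fun z => σ (L⁻¹ • z)) x⟫) +
        γ * ∫ x, ‖V x‖ ^ 2 * ⟪x, gradient (fun z => σ (L⁻¹ • z)) x⟫) :
    HasDerivAt (fun L : ℝ => L ^ (2 / γ - 5) * ∫ y, σ (L⁻¹ • y) * ‖V y‖ ^ 2)
      (γ⁻¹ * L ^ (2 / γ - 6) *
        ∫ x, (‖V x‖ ^ 2 + 2 * P x) * ⟪V x, gradient (fun z => σ (L⁻¹ • z)) x⟫) L := by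
  -- adapted from `hasDerivAt_normEnergy_of_energyEquality` (…EnergySaturationIdentity), `1/(2+ρ) ↦ γ`
  have hσ1 : ContDiff ℝ 1 σ := hσ.contDiff.of_le (by norm_cast)
  have hσd : Differentiable ℝ σ := hσ1.differentiable one_ne_zero
  obtain ⟨-, hI⟩ := hasDerivAt_cutoffEnergy hσ1 hσ.hasCompactSupport hVm hV2 hL
  have hpow : HasDerivAt (fun L : ℝ => L ^ (2 / γ - 5)) ((2 / γ - 5) * L ^ (2 / γ - 5 - 1)) L :=
    Real.hasDerivAt_rpow_const (Or.inl hL.ne')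
  have hprod : HasDerivAt (fun L : ℝ => L ^ (2 / γ - 5) * ∫ y, σ (L⁻¹ • y) * ‖V y‖ ^ 2)
      ((2 / γ - 5) * L ^ (2 / γ - 5 - 1) * (∫ y, σ (L⁻¹ • y) * ‖V y‖ ^ 2) +
        L ^ (2 / γ - 5) * ∫ y, (-(L ^ 2)⁻¹ * fderiv ℝ σ (L⁻¹ • y) y) * ‖V y‖ ^ 2) L :=
    hpow.mul hI
  refine hprod.congr_deriv ?_
  have heuler : ∫ x, ‖V x‖ ^ 2 * ⟪x, gradient (fun z => σ (L⁻¹ • z)) x⟫ =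
      -L * ∫ y, (-(L ^ 2)⁻¹ * fderiv ℝ σ (L⁻¹ • y) y) * ‖V y‖ ^ 2 := by
    rw [← integral_const_mul]
    refine integral_congr_ae (Eventually.of_forall fun y => ?_)
    show ‖V y‖ ^ 2 * ⟪y, gradient (fun z => σ (L⁻¹ • z)) y⟫ =
      -L * (-(L ^ 2)⁻¹ * fderiv ℝ σ (L⁻¹ • y) y * ‖V y‖ ^ 2)
    rw [inner_self_gradient_comp_inv_smul hσd, map_smul, smul_eq_mul]
    field_simp
  have hflux : (∫ x, (‖V x‖ ^ 2 + 2 * P x) * ⟪V x, gradient (fun z => σ (L⁻¹ • z)) x⟫) =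
      (2 - 5 * γ) * (∫ x, σ (L⁻¹ • x) * ‖V x‖ ^ 2) -
        γ * (-L * ∫ y, (-(L ^ 2)⁻¹ * fderiv ℝ σ (L⁻¹ • y) y) * ‖V y‖ ^ 2) := by
    rw [← heuler]; linarith
  rw [hflux]
  have e1 : L ^ (2 / γ - 5 - 1) = L ^ (2 / γ - 6) := by
    congr 1; ring
  have e2 : L ^ (2 / γ - 5) = L ^ (2 / γ - 6) * L := by
    rw [show 2 / γ - 5 = (2 / γ - 6) + 1 by ring, Real.rpow_add hL, Real.rpow_one]
  rw [e1, e2]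
  field_simp
  ring

end ScaleODE

end EnergySaturation

end Summit.NavierStokesRegularity.NavierStokesRegularity.Theorems.PowerGaugeEulerLiouville

end
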